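import Mathlib
import Literature.Analysis.FluidPDE.GalerkinFlow
import Literature.Analysis.FluidPDE.NSGalerkinTrajectory
import Summits.AnomalousDissipation.AnomalousDissipation.Theorems.WazewskiBlockUniformGalerkinTrapStubAeOrbitMem
import Summits.AnomalousDissipation.AnomalousDissipation.Theorems.WazewskiBlockUniformGalerkinTrapStubGalerkinRegularity
import Summits.AnomalousDissipation.AnomalousDissipation.Theorems.WazewskiBlockUniformGalerkinTrapStubWorkLipschitz
import HarnessLib

/-!
# Crux `WazewskiBlock.UniformGalerkinTrap` (stmt-AnomalousDissipation-10352), line `SketchIdeator5`: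
# the strain-bound (purely statistical) form of the bet implies the registered bet

The registered bet `stub_boundedExcessLoudCore` of the line lets the witness law supply its own a.e. time-Lipschitz
constant `L` of the injection. This file proves that the purely statistical form of the card's Transfer — NO
Lipschitz clause, the floor inequality stated with the explicit worst-case constant
`L = ‖f‖₂² + ν₀ (2E)^{1/2} ‖Δf‖₂ + 2 D E` for a strain bound `D` of the force (`|⟪w, Df(x) w⟫| ≤ D ‖w‖²`) —
IMPLIES the registered bet: along a.e. orbit of a law carried by the capped core (`stub_aeOrbitMem`, plumbing
`stub_galerkinRegularity`) the coefficient orbit is a field-level Galerkin trajectory with energy `≤ E`, so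
`stub_workLipschitz` gives the Lipschitz clause with the explicit constant (monotone in `ν ≤ ν₀`). Hence the
registered bet is the WEAKER statement (kit j018974: the dynamical constant is ≈ 23× below the worst case).

* `stub_boundedExcessLoudCore_of_strainBound` — registered tools stub (last theorem).
-/

noncomputable section

-- `Summit.<Summit>.<Problem>` is the tree's mandated summit-side namespace (CONVENTIONS §2); deliberate duplicate.
set_option linter.dupNamespace false

namespace Summit.AnomalousDissipation.AnomalousDissipation.Theorems.UniformGalerkinTrap.Mane

open scoped InnerProductSpace ENNReal NNReal
open MeasureTheory Set Filter Topology
open Literature.Analysis.FunctionSpaces Literature.Analysis.FunctionSpaces.Torus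
open Literature.Analysis.FluidPDE

/-- **The strain-bound form of the bet implies the registered bet** (see the module docstring). [folklore] -/
theorem stub_boundedExcessLoudCore_of_strainBound :
    (∃ (m : ℕ) (f : UnitAddTorus (Fin 3) → EuclideanSpace ℝ (Fin 3)),
      ((IsSmooth f ∧ IsDivFree f ∧ ∀ k : Fin 3 → ℤ, ((m : ℕ) : ℝ) ^ 2 < freqNormSq k →
        UnitAddTorus.mFourierCoeff (EuclideanSpace.complexify ∘ f) k = 0) ∧ HasZeroMean f) ∧
      ∃ (E ε₀ ν₀ D : ℝ), 0 < ε₀ ∧ 0 < ν₀ ∧ 0 ≤ D ∧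
        (∀ (x : UnitAddTorus (Fin 3)) (w : EuclideanSpace ℝ (Fin 3)),
          |⟪w, convect (fun _ => w) f x⟫_ℝ| ≤ D * ‖w‖ ^ 2) ∧
        ∀ ν : ℝ, 0 < ν → ν ≤ ν₀ → ∃ (G : ℝ≥0) (N₀ : ℕ), m ≤ N₀ ∧ ∀ N : ℕ, N₀ ≤ N →
          ∃ (β C : ℝ) (μ : Measure (↥(freqBall (d := Fin 3) N) → EuclideanSpace ℂ (Fin 3))),
            Real.sqrt (2 * C * ((∫ x, ‖f x‖ ^ 2) + ν₀ * Real.sqrt (2 * E) *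
              Real.sqrt (∫ x, ‖laplacian f x‖ ^ 2) + 2 * D * E)) ≤ β - ε₀ ∧
            IsProbabilityMeasure μ ∧
            (∀ t : ℝ, 0 ≤ t →
              μ.map (galerkinCoeffFlow ν (fourierRestrict (freqBall (d := Fin 3) N) f) t) = μ) ∧
            μ {c : ↥(freqBall (d := Fin 3) N) → EuclideanSpace ℂ (Fin 3) |
                c ∈ galerkinSubspace (freqBall (d := Fin 3) N) ∧
                kineticEnergy (realTrigPoly (freqBall N) (coeffExt (freqBall N) c)) ≤ E ∧
                eGradNormSq (realTrigPoly (freqBall N) (coeffExt (freqBall N) c)) ≤ (G : ℝ≥0∞)}ᶜ = 0 ∧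
            ∫ c, (∫ x, ⟪f x, realTrigPoly (freqBall N) (coeffExt (freqBall N) c) x⟫_ℝ) ∂μ = β ∧
            (∀ᵐ c ∂μ, ∀ t : ℝ, 0 ≤ t →
              ∫ τ in (0 : ℝ)..t, (∫ x, ⟪f x, realTrigPoly (freqBall N) (coeffExt (freqBall N)
                (galerkinCoeffFlow ν (fourierRestrict (freqBall (d := Fin 3) N) f) τ c)) x⟫_ℝ) ≤
                β * t + C)) →
    ∃ (m : ℕ) (f : UnitAddTorus (Fin 3) → EuclideanSpace ℝ (Fin 3)),
      ((IsSmooth f ∧ IsDivFree f ∧ ∀ k : Fin 3 → ℤ, ((m : ℕ) : ℝ) ^ 2 < freqNormSq k →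
        UnitAddTorus.mFourierCoeff (EuclideanSpace.complexify ∘ f) k = 0) ∧ HasZeroMean f) ∧
      ∃ (E ε₀ ν₀ : ℝ), 0 < ε₀ ∧ 0 < ν₀ ∧
        ∀ ν : ℝ, 0 < ν → ν ≤ ν₀ → ∃ (G : ℝ≥0) (N₀ : ℕ), ∀ N : ℕ, N₀ ≤ N →
          ∃ (β C L : ℝ) (μ : Measure (↥(freqBall (d := Fin 3) N) → EuclideanSpace ℂ (Fin 3))),
            0 ≤ L ∧ Real.sqrt (2 * C * L) ≤ β - ε₀ ∧
            IsProbabilityMeasure μ ∧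
            (∀ t : ℝ, 0 ≤ t →
              μ.map (galerkinCoeffFlow ν (fourierRestrict (freqBall (d := Fin 3) N) f) t) = μ) ∧
            μ {c : ↥(freqBall (d := Fin 3) N) → EuclideanSpace ℂ (Fin 3) |
                c ∈ galerkinSubspace (freqBall (d := Fin 3) N) ∧
                kineticEnergy (realTrigPoly (freqBall N) (coeffExt (freqBall N) c)) ≤ E ∧
                eGradNormSq (realTrigPoly (freqBall N) (coeffExt (freqBall N) c)) ≤ (G : ℝ≥0∞)}ᶜ = 0 ∧
            ∫ c, (∫ x, ⟪f x, realTrigPoly (freqBall N) (coeffExt (freqBall N) c) x⟫_ℝ) ∂μ = β ∧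
            (∀ᵐ c ∂μ, ∀ s t : ℝ, 0 ≤ s → 0 ≤ t →
              |(∫ x, ⟪f x, realTrigPoly (freqBall N) (coeffExt (freqBall N)
                  (galerkinCoeffFlow ν (fourierRestrict (freqBall (d := Fin 3) N) f) t c)) x⟫_ℝ) -
                ∫ x, ⟪f x, realTrigPoly (freqBall N) (coeffExt (freqBall N)
                  (galerkinCoeffFlow ν (fourierRestrict (freqBall (d := Fin 3) N) f) s c)) x⟫_ℝ| ≤
                L * |t - s|) ∧
            (∀ᵐ c ∂μ, ∀ t : ℝ, 0 ≤ t →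
              ∫ τ in (0 : ℝ)..t, (∫ x, ⟪f x, realTrigPoly (freqBall N) (coeffExt (freqBall N)
                (galerkinCoeffFlow ν (fourierRestrict (freqBall (d := Fin 3) N) f) τ c)) x⟫_ℝ) ≤
                β * t + C) := by
  rintro ⟨m, f, hF, E, ε₀, ν₀, D, hε₀, hν₀, hD, hstrain, hbet⟩
  refine ⟨m, f, hF, E, ε₀, ν₀, hε₀, hν₀, fun ν hν hνle => ?_⟩
  obtain ⟨G, N₀, hmN₀, hN⟩ := hbet ν hν hνle
  refine ⟨G, N₀, fun N hN₀N => ?_⟩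
  obtain ⟨β, C, μ, hgap, hprob, hinv, hcore, hmean, hexcess⟩ := hN N hN₀N
  have hfL2 : MemLp f 2 volume := hF.1.1.memLp 2
  have hfi : Integrable f volume := hfL2.integrable one_le_two
  have hfmode : IsGalerkinMode m f := hF.1
  have hmN : m ≤ N := hmN₀.trans hN₀N
  obtain ⟨hmeas, hcont, -, -, hKclosed⟩ := stub_galerkinRegularity ν N f E G hν.le hfL2
  have h0 : ∀ c : ↥(freqBall (d := Fin 3) N) → EuclideanSpace ℂ (Fin 3),
      galerkinCoeffFlow ν (fourierRestrict (freqBall (d := Fin 3) N) f) 0 c = c :=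
    fun c => galerkinCoeffFlow_zero c
  haveI := hprob
  have haemem := stub_aeOrbitMem (galerkinCoeffFlow ν (fourierRestrict (freqBall (d := Fin 3) N) f)) μ
    {c : ↥(freqBall (d := Fin 3) N) → EuclideanSpace ℂ (Fin 3) |
        c ∈ galerkinSubspace (freqBall (d := Fin 3) N) ∧
        kineticEnergy (realTrigPoly (freqBall N) (coeffExt (freqBall N) c)) ≤ E ∧
        eGradNormSq (realTrigPoly (freqBall N) (coeffExt (freqBall N) c)) ≤ (G : ℝ≥0∞)}
    hmeas h0 hcont hinv hKclosed hcore
  -- the core is nonempty (it carries a probability measure), so `E ≥ 0`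
  have haeK : ∀ᵐ c ∂μ, c ∈ {c : ↥(freqBall (d := Fin 3) N) → EuclideanSpace ℂ (Fin 3) |
        c ∈ galerkinSubspace (freqBall (d := Fin 3) N) ∧
        kineticEnergy (realTrigPoly (freqBall N) (coeffExt (freqBall N) c)) ≤ E ∧
        eGradNormSq (realTrigPoly (freqBall N) (coeffExt (freqBall N) c)) ≤ (G : ℝ≥0∞)} :=
    mem_ae_iff.2 hcore
  obtain ⟨c₀, hc₀⟩ := haeK.exists
  have hE0 : 0 ≤ E := (Torus.kineticEnergy_nonneg _).trans hc₀.2.1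
  have hf2 : 0 ≤ ∫ x, ‖f x‖ ^ 2 := integral_nonneg fun _ => sq_nonneg _
  refine ⟨β, C, (∫ x, ‖f x‖ ^ 2) + ν₀ * Real.sqrt (2 * E) * Real.sqrt (∫ x, ‖laplacian f x‖ ^ 2) + 2 * D * E,
    μ, by positivity, hgap, hprob, hinv, hcore, hmean, ?_, hexcess⟩
  filter_upwards [haemem] with c hmem
  have hcK := hmem 0 le_rfl
  rw [h0 c] at hcK
  obtain ⟨hcV, -, -⟩ := hcK
  have ha : IsGalerkinMode N (realTrigPoly (freqBall N) (coeffExt (freqBall N) c)) :=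
    isGalerkinMode_realTrigPoly_coeffExt hcV
  have hrestr : fourierRestrict (freqBall (d := Fin 3) N) (realTrigPoly (freqBall N) (coeffExt (freqBall N) c)) = c :=
    fourierRestrict_realTrigPoly_coeffExt neg_mem_freqBall_of_mem hcV.1
  have htraj : Torus.IsGalerkinTrajectory ν f N (fun t => realTrigPoly (freqBall N) (coeffExt (freqBall N)
      (galerkinCoeffFlow ν (fourierRestrict (freqBall (d := Fin 3) N) f) t c))) := by
    have h := (ha.isGalerkinTrajectory_galerkinFlow hν.le hfi).torus hfL2
    rw [hrestr] at h
    exact h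
  have hKEorb : ∀ τ : ℝ, 0 ≤ τ → kineticEnergy (realTrigPoly (freqBall N) (coeffExt (freqBall N)
      (galerkinCoeffFlow ν (fourierRestrict (freqBall (d := Fin 3) N) f) τ c))) ≤ E :=
    fun τ hτ => (hmem τ hτ).2.1
  have hlipν := stub_workLipschitz ν m N f E D _ hfmode hmN hν.le hD htraj hKEorb hstrain
  intro s t hs ht
  refine (hlipν s t hs ht).trans (mul_le_mul_of_nonneg_right ?_ (abs_nonneg _))
  have : ν * Real.sqrt (2 * E) * Real.sqrt (∫ x, ‖laplacian f x‖ ^ 2) ≤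
      ν₀ * Real.sqrt (2 * E) * Real.sqrt (∫ x, ‖laplacian f x‖ ^ 2) := by
    have h1 : 0 ≤ Real.sqrt (2 * E) * Real.sqrt (∫ x, ‖laplacian f x‖ ^ 2) :=
      mul_nonneg (Real.sqrt_nonneg _) (Real.sqrt_nonneg _)
    nlinarith
  linarith

end Summit.AnomalousDissipation.AnomalousDissipation.Theorems.UniformGalerkinTrap.Mane

end
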